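import Literature.NumberTheory.LFunctions.DirichletLTruncationCertificates
import HarnessLib

/-!
# No real zero for the EVEN real primitive characters of conductor `437 ≤ q ≤ 500`, in the kernel
# (Davenport–Chua truncation certificates)

Topic `Literature/NumberTheory/LFunctions`; namespace `Literature.NumberTheory.LFunctions`
(private per-modulus work in `Literature.NumberTheory.LFunctions.EvenTruncationI`). THEOREMS only (no
definition, no named fact, no `sorry`): **`noRealZeroEven_range_437_500`** — for every modulus
`437 ≤ q ≤ 500`, every primitive quadratic EVEN `χ` mod `q` and every `σ ∈ (0, 1)`, `L(σ, χ) ≠ 0`.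

Per modulus (one bullet each, in the order of `interval_cases`): moduli without a primitive quadratic
character are dismissed (`q ≡ 2 (mod 4)`, `16 ∣ q`, `p² ∣ q` — MV Thm 9.13); the ODD primitive quadratic
character is excluded by the parity test inside `LTruncationCert.good_even_of_*`; the EVEN one (real
quadratic field of discriminant `q`) is certified by **`LTruncationCert.certOK v q 16 32`**
(`DirichletLTruncationCertificates.lean`): the one-period truncation `∑_{n ≤ q} χ(n) n^{−σ}` dominates the
second-order tail bound `B/(2(q+1)^{3/2})` on each of `16` cells covering `[1/2, 1]` (fixed point `2^{−32}`,
roots by bisection in the kernel), and the functional equation reflects `(0, 1/2)` to `(1/2, 1)`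
(`DirichletLTruncationBound.lean`). 22 certificates in this file; `B = max_N |∑_{K ≤ N} S(K)|` and the
worst cell margin of each are recorded in the bullets. [cite: Chua2005RealZeros, §2.2 ALGO 1]

## References

* K. S. Chua, *Real zeros of Dedekind zeta functions of real quadratic fields*, Math. Comp. 74 (2005)
  1457–1470, §2. [Chua2005RealZeros]
* H. L. Montgomery, R. C. Vaughan, *Multiplicative Number Theory I*, CUP 2007, §9.3 Thm 9.13, §10.1.
  [MontgomeryVaughan2007]
-/

namespace Literature.NumberTheory.LFunctions

namespace EvenTruncationI

open FeketePolyaKernel PrimitiveQuadratic LTruncationCert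

/-- Conductor `≡ 2 (mod 4)`: no primitive character (private copy of the sweep-4 lemma).
[cite: MontgomeryVaughan2007, §9.3 Theorem 9.13] -/
private theorem absurd_of_mod_four_two {q : ℕ} [NeZero q] (hq : q % 4 = 2)
    {χ : DirichletCharacter ℂ q} (hprim : χ.IsPrimitive) : False := by
  obtain ⟨m, rfl⟩ : ∃ m, q = 2 * m := ⟨q / 2, by omega⟩
  haveI : NeZero m := ⟨by omega⟩
  exact not_isPrimitive_two_mul (m := m) (Nat.odd_iff.mpr (by omega)) hprim

/-- Conductor divisible by `16`: no primitive quadratic character (private copy).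
[cite: MontgomeryVaughan2007, §9.3 Theorem 9.13] -/
private theorem absurd_of_sixteen_dvd {q : ℕ} [NeZero q] (hq : q % 16 = 0) {χ : DirichletCharacter ℂ q}
    (hprim : χ.IsPrimitive) (hquad : χ.IsQuadratic) : False := by
  obtain ⟨k, m, hm, rfl⟩ := Nat.exists_eq_two_pow_mul_odd (NeZero.ne q)
  have hm2 := Nat.odd_iff.mp hm
  haveI : NeZero m := ⟨by omega⟩
  have hk := le_three_of_level_two_pow_mul hm hprim hquad
  interval_cases k <;> norm_num at hq <;> omega

/-- Conductor with an odd square factor `p²`: no primitive quadratic character (private copy).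
[cite: MontgomeryVaughan2007, §9.3 Theorem 9.13] -/
private theorem absurd_of_sq_dvd {q : ℕ} [NeZero q] {p : ℕ} (hp : p.Prime) (hp2 : p ≠ 2)
    (hpq : p * p ∣ q) {χ : DirichletCharacter ℂ q} (hprim : χ.IsPrimitive) (hquad : χ.IsQuadratic) :
    False := by
  obtain ⟨k, m, hm, rfl⟩ := Nat.exists_eq_two_pow_mul_odd (NeZero.ne q)
  have hm2 := Nat.odd_iff.mp hm
  haveI : NeZero m := ⟨by omega⟩
  have hsq := squarefree_of_level_two_pow_mul hm hprim hquad
  have hp2' : Nat.Coprime p 2 := (Nat.coprime_primes hp Nat.prime_two).mpr hp2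
  have hcop : Nat.Coprime (p * p) (2 ^ k) := Nat.Coprime.pow_right k (Nat.Coprime.mul_left hp2' hp2')
  have hpm : p * p ∣ m := hcop.dvd_of_dvd_mul_left hpq
  exact hp.one_lt.ne' (Nat.isUnit_iff.mp (hsq p hpm))

/-- `437`: the even character `(·/437)` — truncation certificate `J = 16`, `P = 32` (`B = 815`, worst cell margin `0.053`). [cite: Chua2005RealZeros, §2.2 ALGO 1] -/
private theorem good437 :
    ∀ χ : DirichletCharacter ℂ 437, χ.IsQuadratic → χ.IsPrimitive → χ.Even →
      ∀ σ : ℝ, 0 < σ → σ < 1 → χ.LFunction σ ≠ 0 :=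
  good_even_of_odd (by decide) (by decide) 16 32 (by decide +kernel)

/-- `440 = 8·55`: the even character `χ₋₈·(·/55)` — truncation certificate `J = 16`, `P = 32` (`B = 830`, worst cell margin `0.531`); the other primitive quadratic character mod `440` is odd (parity test). [cite: Chua2005RealZeros, §2.2 ALGO 1] -/
private theorem good440 :
    ∀ χ : DirichletCharacter ℂ 440, χ.IsQuadratic → χ.IsPrimitive → χ.Even →
      ∀ σ : ℝ, 0 < σ → σ < 1 → χ.LFunction σ ≠ 0 :=
  good_even_of_eight (by decide) (by decide) 16 32 (by decide +kernel) (by decide +kernel)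

/-- `444 = 4·111`: the even character `χ₋₄·(·/111)` — truncation certificate `J = 16`, `P = 32` (`B = 976`, worst cell margin `0.958`). [cite: Chua2005RealZeros, §2.2 ALGO 1] -/
private theorem good444 :
    ∀ χ : DirichletCharacter ℂ 444, χ.IsQuadratic → χ.IsPrimitive → χ.Even →
      ∀ σ : ℝ, 0 < σ → σ < 1 → χ.LFunction σ ≠ 0 :=
  good_even_of_four (by decide) (by decide) 16 32 (by decide +kernel)

/-- `445`: the even character `(·/445)` — truncation certificate `J = 16`, `P = 32` (`B = 1100`, worst cell margin `0.909`). [cite: Chua2005RealZeros, §2.2 ALGO 1] -/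
private theorem good445 :
    ∀ χ : DirichletCharacter ℂ 445, χ.IsQuadratic → χ.IsPrimitive → χ.Even →
      ∀ σ : ℝ, 0 < σ → σ < 1 → χ.LFunction σ ≠ 0 :=
  good_even_of_odd (by decide) (by decide) 16 32 (by decide +kernel)

/-- `449`: the even character `(·/449)` — truncation certificate `J = 16`, `P = 32` (`B = 1024`, worst cell margin `1.513`). [cite: Chua2005RealZeros, §2.2 ALGO 1] -/
private theorem good449 :
    ∀ χ : DirichletCharacter ℂ 449, χ.IsQuadratic → χ.IsPrimitive → χ.Even →
      ∀ σ : ℝ, 0 < σ → σ < 1 → χ.LFunction σ ≠ 0 :=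
  good_even_of_odd (by decide) (by decide) 16 32 (by decide +kernel)

/-- `453`: the even character `(·/453)` — truncation certificate `J = 16`, `P = 32` (`B = 936`, worst cell margin `0.270`). [cite: Chua2005RealZeros, §2.2 ALGO 1] -/
private theorem good453 :
    ∀ χ : DirichletCharacter ℂ 453, χ.IsQuadratic → χ.IsPrimitive → χ.Even →
      ∀ σ : ℝ, 0 < σ → σ < 1 → χ.LFunction σ ≠ 0 :=
  good_even_of_odd (by decide) (by decide) 16 32 (by decide +kernel)

/-- `456 = 8·57`: the even character `χ₈·(·/57)` — truncation certificate `J = 16`, `P = 32` (`B = 1056`, worst cell margin `1.142`); the other primitive quadratic character mod `456` is odd (parity test). [cite: Chua2005RealZeros, §2.2 ALGO 1] -/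
private theorem good456 :
    ∀ χ : DirichletCharacter ℂ 456, χ.IsQuadratic → χ.IsPrimitive → χ.Even →
      ∀ σ : ℝ, 0 < σ → σ < 1 → χ.LFunction σ ≠ 0 :=
  good_even_of_eight (by decide) (by decide) 16 32 (by decide +kernel) (by decide +kernel)

/-- `457`: the even character `(·/457)` — truncation certificate `J = 16`, `P = 32` (`B = 1131`, worst cell margin `1.951`). [cite: Chua2005RealZeros, §2.2 ALGO 1] -/
private theorem good457 :
    ∀ χ : DirichletCharacter ℂ 457, χ.IsQuadratic → χ.IsPrimitive → χ.Even →
      ∀ σ : ℝ, 0 < σ → σ < 1 → χ.LFunction σ ≠ 0 :=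
  good_even_of_odd (by decide) (by decide) 16 32 (by decide +kernel)

/-- `460 = 4·115`: the even character `χ₋₄·(·/115)` — truncation certificate `J = 16`, `P = 32` (`B = 1112`, worst cell margin `1.147`). [cite: Chua2005RealZeros, §2.2 ALGO 1] -/
private theorem good460 :
    ∀ χ : DirichletCharacter ℂ 460, χ.IsQuadratic → χ.IsPrimitive → χ.Even →
      ∀ σ : ℝ, 0 < σ → σ < 1 → χ.LFunction σ ≠ 0 :=
  good_even_of_four (by decide) (by decide) 16 32 (by decide +kernel)

/-- `461`: the even character `(·/461)` — truncation certificate `J = 16`, `P = 32` (`B = 916`, worst cell margin `0.394`). [cite: Chua2005RealZeros, §2.2 ALGO 1] -/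
private theorem good461 :
    ∀ χ : DirichletCharacter ℂ 461, χ.IsQuadratic → χ.IsPrimitive → χ.Even →
      ∀ σ : ℝ, 0 < σ → σ < 1 → χ.LFunction σ ≠ 0 :=
  good_even_of_odd (by decide) (by decide) 16 32 (by decide +kernel)

/-- `465`: the even character `(·/465)` — truncation certificate `J = 16`, `P = 32` (`B = 1085`, worst cell margin `1.558`). [cite: Chua2005RealZeros, §2.2 ALGO 1] -/
private theorem good465 :
    ∀ χ : DirichletCharacter ℂ 465, χ.IsQuadratic → χ.IsPrimitive → χ.Even →
      ∀ σ : ℝ, 0 < σ → σ < 1 → χ.LFunction σ ≠ 0 :=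
  good_even_of_odd (by decide) (by decide) 16 32 (by decide +kernel)

/-- `469`: the even character `(·/469)` — truncation certificate `J = 16`, `P = 32` (`B = 1200`, worst cell margin `0.905`). [cite: Chua2005RealZeros, §2.2 ALGO 1] -/
private theorem good469 :
    ∀ χ : DirichletCharacter ℂ 469, χ.IsQuadratic → χ.IsPrimitive → χ.Even →
      ∀ σ : ℝ, 0 < σ → σ < 1 → χ.LFunction σ ≠ 0 :=
  good_even_of_odd (by decide) (by decide) 16 32 (by decide +kernel)

/-- `472 = 8·59`: the even character `χ₋₈·(·/59)` — truncation certificate `J = 16`, `P = 32` (`B = 1108`, worst cell margin `0.965`); the other primitive quadratic character mod `472` is odd (parity test). [cite: Chua2005RealZeros, §2.2 ALGO 1] -/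
private theorem good472 :
    ∀ χ : DirichletCharacter ℂ 472, χ.IsQuadratic → χ.IsPrimitive → χ.Even →
      ∀ σ : ℝ, 0 < σ → σ < 1 → χ.LFunction σ ≠ 0 :=
  good_even_of_eight (by decide) (by decide) 16 32 (by decide +kernel) (by decide +kernel)

/-- `473`: the even character `(·/473)` — truncation certificate `J = 16`, `P = 32` (`B = 1073`, worst cell margin `1.132`). [cite: Chua2005RealZeros, §2.2 ALGO 1] -/
private theorem good473 :
    ∀ χ : DirichletCharacter ℂ 473, χ.IsQuadratic → χ.IsPrimitive → χ.Even →
      ∀ σ : ℝ, 0 < σ → σ < 1 → χ.LFunction σ ≠ 0 :=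
  good_even_of_odd (by decide) (by decide) 16 32 (by decide +kernel)

/-- `476 = 4·119`: the even character `χ₋₄·(·/119)` — truncation certificate `J = 16`, `P = 32` (`B = 992`, worst cell margin `0.785`). [cite: Chua2005RealZeros, §2.2 ALGO 1] -/
private theorem good476 :
    ∀ χ : DirichletCharacter ℂ 476, χ.IsQuadratic → χ.IsPrimitive → χ.Even →
      ∀ σ : ℝ, 0 < σ → σ < 1 → χ.LFunction σ ≠ 0 :=
  good_even_of_four (by decide) (by decide) 16 32 (by decide +kernel)

/-- `481`: the even character `(·/481)` — truncation certificate `J = 16`, `P = 32` (`B = 1253`, worst cell margin `2.163`). [cite: Chua2005RealZeros, §2.2 ALGO 1] -/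
private theorem good481 :
    ∀ χ : DirichletCharacter ℂ 481, χ.IsQuadratic → χ.IsPrimitive → χ.Even →
      ∀ σ : ℝ, 0 < σ → σ < 1 → χ.LFunction σ ≠ 0 :=
  good_even_of_odd (by decide) (by decide) 16 32 (by decide +kernel)

/-- `485`: the even character `(·/485)` — truncation certificate `J = 16`, `P = 32` (`B = 1010`, worst cell margin `0.521`). [cite: Chua2005RealZeros, §2.2 ALGO 1] -/
private theorem good485 :
    ∀ χ : DirichletCharacter ℂ 485, χ.IsQuadratic → χ.IsPrimitive → χ.Even →
      ∀ σ : ℝ, 0 < σ → σ < 1 → χ.LFunction σ ≠ 0 :=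
  good_even_of_odd (by decide) (by decide) 16 32 (by decide +kernel)

/-- `488 = 8·61`: the even character `χ₈·(·/61)` — truncation certificate `J = 16`, `P = 32` (`B = 968`, worst cell margin `0.351`); the other primitive quadratic character mod `488` is odd (parity test). [cite: Chua2005RealZeros, §2.2 ALGO 1] -/
private theorem good488 :
    ∀ χ : DirichletCharacter ℂ 488, χ.IsQuadratic → χ.IsPrimitive → χ.Even →
      ∀ σ : ℝ, 0 < σ → σ < 1 → χ.LFunction σ ≠ 0 :=
  good_even_of_eight (by decide) (by decide) 16 32 (by decide +kernel) (by decide +kernel)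

/-- `489`: the even character `(·/489)` — truncation certificate `J = 16`, `P = 32` (`B = 1176`, worst cell margin `1.726`). [cite: Chua2005RealZeros, §2.2 ALGO 1] -/
private theorem good489 :
    ∀ χ : DirichletCharacter ℂ 489, χ.IsQuadratic → χ.IsPrimitive → χ.Even →
      ∀ σ : ℝ, 0 < σ → σ < 1 → χ.LFunction σ ≠ 0 :=
  good_even_of_odd (by decide) (by decide) 16 32 (by decide +kernel)

/-- `492 = 4·123`: the even character `χ₋₄·(·/123)` — truncation certificate `J = 16`, `P = 32` (`B = 1080`, worst cell margin `0.770`). [cite: Chua2005RealZeros, §2.2 ALGO 1] -/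
private theorem good492 :
    ∀ χ : DirichletCharacter ℂ 492, χ.IsQuadratic → χ.IsPrimitive → χ.Even →
      ∀ σ : ℝ, 0 < σ → σ < 1 → χ.LFunction σ ≠ 0 :=
  good_even_of_four (by decide) (by decide) 16 32 (by decide +kernel)

/-- `493`: the even character `(·/493)` — truncation certificate `J = 16`, `P = 32` (`B = 1190`, worst cell margin `0.647`). [cite: Chua2005RealZeros, §2.2 ALGO 1] -/
private theorem good493 :
    ∀ χ : DirichletCharacter ℂ 493, χ.IsQuadratic → χ.IsPrimitive → χ.Even →
      ∀ σ : ℝ, 0 < σ → σ < 1 → χ.LFunction σ ≠ 0 :=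
  good_even_of_odd (by decide) (by decide) 16 32 (by decide +kernel)

/-- `497`: the even character `(·/497)` — truncation certificate `J = 16`, `P = 32` (`B = 1138`, worst cell margin `1.042`). [cite: Chua2005RealZeros, §2.2 ALGO 1] -/
private theorem good497 :
    ∀ χ : DirichletCharacter ℂ 497, χ.IsQuadratic → χ.IsPrimitive → χ.Even →
      ∀ σ : ℝ, 0 < σ → σ < 1 → χ.LFunction σ ≠ 0 :=
  good_even_of_odd (by decide) (by decide) 16 32 (by decide +kernel)

/-- **No real zero in `(0, 1)` for every even real primitive character of conductor `437 ≤ q ≤ 500`**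
(one bullet per modulus, in the order of `interval_cases`). [cite: Chua2005RealZeros, §2.2 ALGO 1] -/
theorem range_437_500 (q : ℕ) [NeZero q] (hlo : 436 < q) (hhi : q ≤ 500) :
    ∀ χ : DirichletCharacter ℂ q, χ.IsQuadratic → χ.IsPrimitive → χ.Even →
      ∀ σ : ℝ, 0 < σ → σ < 1 → χ.LFunction σ ≠ 0 := by
  interval_cases q
  · exact good437 -- certificate
  · -- 438 ≡ 2 (mod 4): no primitive character
    exact fun χ _ hprim _ ↦ (absurd_of_mod_four_two (by decide) hprim).elim
  · -- 439 ≡ 3 (mod 4): the primitive quadratic character (·/439) is odd (parity test)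
    exact good_even_of_odd (by decide) (by decide) 16 32 (by decide +kernel)
  · exact good440 -- certificate
  · -- 3² ∣ 441: no primitive quadratic character
    exact fun χ hquad hprim _ ↦
      (absurd_of_sq_dvd (p := 3) (by norm_num) (by decide) (by decide) hprim hquad).elim
  · -- 442 ≡ 2 (mod 4): no primitive character
    exact fun χ _ hprim _ ↦ (absurd_of_mod_four_two (by decide) hprim).elim
  · -- 443 ≡ 3 (mod 4): the primitive quadratic character (·/443) is odd (parity test)
    exact good_even_of_odd (by decide) (by decide) 16 32 (by decide +kernel)
  · exact good444 -- certificate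
  · exact good445 -- certificate
  · -- 446 ≡ 2 (mod 4): no primitive character
    exact fun χ _ hprim _ ↦ (absurd_of_mod_four_two (by decide) hprim).elim
  · -- 447 ≡ 3 (mod 4): the primitive quadratic character (·/447) is odd (parity test)
    exact good_even_of_odd (by decide) (by decide) 16 32 (by decide +kernel)
  · -- 16 ∣ 448: no primitive quadratic character
    exact fun χ hquad hprim _ ↦ (absurd_of_sixteen_dvd (by decide) hprim hquad).elim
  · exact good449 -- certificate
  · -- 450 ≡ 2 (mod 4): no primitive character
    exact fun χ _ hprim _ ↦ (absurd_of_mod_four_two (by decide) hprim).elim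
  · -- 451 ≡ 3 (mod 4): the primitive quadratic character (·/451) is odd (parity test)
    exact good_even_of_odd (by decide) (by decide) 16 32 (by decide +kernel)
  · -- 452 = 4·113, 113 ≡ 1 (mod 4): the primitive quadratic character is odd (parity test)
    exact good_even_of_four (by decide) (by decide) 16 32 (by decide +kernel)
  · exact good453 -- certificate
  · -- 454 ≡ 2 (mod 4): no primitive character
    exact fun χ _ hprim _ ↦ (absurd_of_mod_four_two (by decide) hprim).elim
  · -- 455 ≡ 3 (mod 4): the primitive quadratic character (·/455) is odd (parity test)
    exact good_even_of_odd (by decide) (by decide) 16 32 (by decide +kernel)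
  · exact good456 -- certificate
  · exact good457 -- certificate
  · -- 458 ≡ 2 (mod 4): no primitive character
    exact fun χ _ hprim _ ↦ (absurd_of_mod_four_two (by decide) hprim).elim
  · -- 3² ∣ 459: no primitive quadratic character
    exact fun χ hquad hprim _ ↦
      (absurd_of_sq_dvd (p := 3) (by norm_num) (by decide) (by decide) hprim hquad).elim
  · exact good460 -- certificate
  · exact good461 -- certificate
  · -- 462 ≡ 2 (mod 4): no primitive character
    exact fun χ _ hprim _ ↦ (absurd_of_mod_four_two (by decide) hprim).elim
  · -- 463 ≡ 3 (mod 4): the primitive quadratic character (·/463) is odd (parity test)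
    exact good_even_of_odd (by decide) (by decide) 16 32 (by decide +kernel)
  · -- 16 ∣ 464: no primitive quadratic character
    exact fun χ hquad hprim _ ↦ (absurd_of_sixteen_dvd (by decide) hprim hquad).elim
  · exact good465 -- certificate
  · -- 466 ≡ 2 (mod 4): no primitive character
    exact fun χ _ hprim _ ↦ (absurd_of_mod_four_two (by decide) hprim).elim
  · -- 467 ≡ 3 (mod 4): the primitive quadratic character (·/467) is odd (parity test)
    exact good_even_of_odd (by decide) (by decide) 16 32 (by decide +kernel)
  · -- 3² ∣ 468: no primitive quadratic character
    exact fun χ hquad hprim _ ↦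
      (absurd_of_sq_dvd (p := 3) (by norm_num) (by decide) (by decide) hprim hquad).elim
  · exact good469 -- certificate
  · -- 470 ≡ 2 (mod 4): no primitive character
    exact fun χ _ hprim _ ↦ (absurd_of_mod_four_two (by decide) hprim).elim
  · -- 471 ≡ 3 (mod 4): the primitive quadratic character (·/471) is odd (parity test)
    exact good_even_of_odd (by decide) (by decide) 16 32 (by decide +kernel)
  · exact good472 -- certificate
  · exact good473 -- certificate
  · -- 474 ≡ 2 (mod 4): no primitive character
    exact fun χ _ hprim _ ↦ (absurd_of_mod_four_two (by decide) hprim).elim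
  · -- 5² ∣ 475: no primitive quadratic character
    exact fun χ hquad hprim _ ↦
      (absurd_of_sq_dvd (p := 5) (by norm_num) (by decide) (by decide) hprim hquad).elim
  · exact good476 -- certificate
  · -- 3² ∣ 477: no primitive quadratic character
    exact fun χ hquad hprim _ ↦
      (absurd_of_sq_dvd (p := 3) (by norm_num) (by decide) (by decide) hprim hquad).elim
  · -- 478 ≡ 2 (mod 4): no primitive character
    exact fun χ _ hprim _ ↦ (absurd_of_mod_four_two (by decide) hprim).elim
  · -- 479 ≡ 3 (mod 4): the primitive quadratic character (·/479) is odd (parity test)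
    exact good_even_of_odd (by decide) (by decide) 16 32 (by decide +kernel)
  · -- 16 ∣ 480: no primitive quadratic character
    exact fun χ hquad hprim _ ↦ (absurd_of_sixteen_dvd (by decide) hprim hquad).elim
  · exact good481 -- certificate
  · -- 482 ≡ 2 (mod 4): no primitive character
    exact fun χ _ hprim _ ↦ (absurd_of_mod_four_two (by decide) hprim).elim
  · -- 483 ≡ 3 (mod 4): the primitive quadratic character (·/483) is odd (parity test)
    exact good_even_of_odd (by decide) (by decide) 16 32 (by decide +kernel)
  · -- 11² ∣ 484: no primitive quadratic character
    exact fun χ hquad hprim _ ↦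
      (absurd_of_sq_dvd (p := 11) (by norm_num) (by decide) (by decide) hprim hquad).elim
  · exact good485 -- certificate
  · -- 486 ≡ 2 (mod 4): no primitive character
    exact fun χ _ hprim _ ↦ (absurd_of_mod_four_two (by decide) hprim).elim
  · -- 487 ≡ 3 (mod 4): the primitive quadratic character (·/487) is odd (parity test)
    exact good_even_of_odd (by decide) (by decide) 16 32 (by decide +kernel)
  · exact good488 -- certificate
  · exact good489 -- certificate
  · -- 490 ≡ 2 (mod 4): no primitive character
    exact fun χ _ hprim _ ↦ (absurd_of_mod_four_two (by decide) hprim).elim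
  · -- 491 ≡ 3 (mod 4): the primitive quadratic character (·/491) is odd (parity test)
    exact good_even_of_odd (by decide) (by decide) 16 32 (by decide +kernel)
  · exact good492 -- certificate
  · exact good493 -- certificate
  · -- 494 ≡ 2 (mod 4): no primitive character
    exact fun χ _ hprim _ ↦ (absurd_of_mod_four_two (by decide) hprim).elim
  · -- 3² ∣ 495: no primitive quadratic character
    exact fun χ hquad hprim _ ↦
      (absurd_of_sq_dvd (p := 3) (by norm_num) (by decide) (by decide) hprim hquad).elim
  · -- 16 ∣ 496: no primitive quadratic character
    exact fun χ hquad hprim _ ↦ (absurd_of_sixteen_dvd (by decide) hprim hquad).elim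
  · exact good497 -- certificate
  · -- 498 ≡ 2 (mod 4): no primitive character
    exact fun χ _ hprim _ ↦ (absurd_of_mod_four_two (by decide) hprim).elim
  · -- 499 ≡ 3 (mod 4): the primitive quadratic character (·/499) is odd (parity test)
    exact good_even_of_odd (by decide) (by decide) 16 32 (by decide +kernel)
  · -- 5² ∣ 500: no primitive quadratic character
    exact fun χ hquad hprim _ ↦
      (absurd_of_sq_dvd (p := 5) (by norm_num) (by decide) (by decide) hprim hquad).elim

end EvenTruncationI

open EvenTruncationI in
/-- **Even real primitive characters of conductor `437 ≤ q ≤ 500` have no real zero in `(0, 1)`.**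
[cite: Chua2005RealZeros, Theorem 1.1 (q ≤ 200 000, here re-proved in the kernel for this range)] -/
theorem noRealZeroEven_range_437_500 (q : ℕ) [NeZero q] (hlo : 436 < q) (hhi : q ≤ 500) :
    ∀ χ : DirichletCharacter ℂ q, χ.IsQuadratic → χ.IsPrimitive → χ.Even →
      ∀ σ : ℝ, 0 < σ → σ < 1 → χ.LFunction σ ≠ 0 :=
  range_437_500 q hlo hhi

end Literature.NumberTheory.LFunctions
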